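import Mathlib
import Summits.Ventures.HodgeRepro2.T5AmiceInverse
import Summits.Ventures.HodgeRepro2.T5AmiceConvolution

/-!
# T5AmiceRingEquiv — «W[[Γ_𝔭]] ≅ W[[T]]» AS RINGS: the bounded measures on `ℤ_p` with convolution are
isomorphic to the bounded power series

Cell pub-hodge-repro2, Tier 5 support (seat p7; route/T5-CHECK-G-p7.md §3 S5). The pieces are in the
tree — injectivity of the Amice transform (T5AmiceTransform p400619), surjectivity onto the bounded power
series (T5AmiceInverse p400741, `amiceEquiv`), multiplicativity for convolution and `f_{δ_0} = 1`
(T5AmiceConvolution p401350, T5AmiceDirac p400809). This file bundles them: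

* `boundedSeries : Subring (PowerSeries R)` — the power series with bounded coefficients (a subring:
  products of bounded series are bounded, by the ultrametric inequality on `coeff n (f g) = Σ a_i b_j`);
* `BoundedMeasure p R` — the bounded functionals on `C(ℤ_p, R)`, with the `CommRing` structure
  transported from `boundedSeries` along the Amice bijection; `mul_val_eq_conv`: the transported product
  IS the convolution, `one_val_eq_dirac_zero`: the unit IS `δ_0`, `add_val` / `zero_val`:
  the additive structure is the pointwise one;
* `amiceRingEquiv : BoundedMeasure p R ≃+* boundedSeries` — the Iwasawa-algebra isomorphism of S5
  «`W[[Γ_𝔭]] ≅ W[[T]]`» as a ring isomorphism, `amiceRingEquiv_apply_coe : ↑(amiceRingEquiv m) = f_m`.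

Mathlib + own T5AmiceInverse (hence T5AmiceTransform), T5AmiceConvolution (hence T5AmiceDirac) only.
-/

namespace Summit.Ventures.HodgeRepro2.T5AmiceRingEquiv

open PadicInt Filter Topology
open Summit.Ventures.HodgeRepro2.T5AmiceTransform
open Summit.Ventures.HodgeRepro2.T5AmiceInverse
open Summit.Ventures.HodgeRepro2.T5AmiceDirac
open Summit.Ventures.HodgeRepro2.T5AmiceConvolution

variable (p : ℕ) [hp : Fact p.Prime]
variable (R : Type*) [NormedCommRing R] [Algebra ℤ_[p] R] [IsBoundedSMul ℤ_[p] R]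
  [IsUltrametricDist R] [CompleteSpace R]

/-! ### The bounded power series form a subring -/

omit [Algebra ℤ_[p] R] [IsBoundedSMul ℤ_[p] R] [CompleteSpace R] in
/-- A product of two bounded power series is bounded (ultrametric inequality on the Cauchy product). -/
theorem exists_forall_norm_coeff_mul_le {f g : PowerSeries R} {C D : ℝ} (hC : 0 ≤ C) (hD : 0 ≤ D)
    (hf : ∀ n, ‖PowerSeries.coeff n f‖ ≤ C) (hg : ∀ n, ‖PowerSeries.coeff n g‖ ≤ D) (n : ℕ) :
    ‖PowerSeries.coeff n (f * g)‖ ≤ C * D := by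
  rw [PowerSeries.coeff_mul]
  refine IsUltrametricDist.norm_sum_le_of_forall_le_of_nonneg (mul_nonneg hC hD) fun ij _ => ?_
  calc ‖PowerSeries.coeff ij.1 f * PowerSeries.coeff ij.2 g‖
      ≤ ‖PowerSeries.coeff ij.1 f‖ * ‖PowerSeries.coeff ij.2 g‖ := norm_mul_le _ _
    _ ≤ C * D := by gcongr; exacts [hf _, hg _]

omit [Algebra ℤ_[p] R] [IsBoundedSMul ℤ_[p] R] [IsUltrametricDist R] [CompleteSpace R] in
/-- A bound can always be taken `≥ 0`. -/
theorem exists_nonneg_bound {f : PowerSeries R} (h : ∃ C, ∀ n, ‖PowerSeries.coeff n f‖ ≤ C) :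
    ∃ C, 0 ≤ C ∧ ∀ n, ‖PowerSeries.coeff n f‖ ≤ C := by
  obtain ⟨C, hC⟩ := h
  exact ⟨max C 0, le_max_right _ _, fun n => (hC n).trans (le_max_left _ _)⟩

omit [Algebra ℤ_[p] R] [IsBoundedSMul ℤ_[p] R] [CompleteSpace R] in
/-- THE BOUNDED POWER SERIES `{f : ∃ C, ‖coeff_n f‖ ≤ C ∀n}` — «`W[[T]]`» for an integral `R` — form a
subring of `R[[T]]`. -/
def boundedSeries : Subring (PowerSeries R) where
  carrier := {f | ∃ C, ∀ n, ‖PowerSeries.coeff n f‖ ≤ C}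
  zero_mem' := ⟨0, fun n => by simp⟩
  one_mem' := ⟨‖(1 : R)‖, fun n => by
    rw [PowerSeries.coeff_one]
    split_ifs <;> simp⟩
  add_mem' := by
    rintro f g ⟨C, hC⟩ ⟨D, hD⟩
    refine ⟨C + D, fun n => ?_⟩
    rw [map_add]
    exact (norm_add_le _ _).trans (add_le_add (hC n) (hD n))
  neg_mem' := by
    rintro f ⟨C, hC⟩
    exact ⟨C, fun n => by rw [map_neg, norm_neg]; exact hC n⟩
  mul_mem' := by
    rintro f g hf hg
    obtain ⟨C, hC0, hC⟩ := exists_nonneg_bound R hf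
    obtain ⟨D, hD0, hD⟩ := exists_nonneg_bound R hg
    exact ⟨C * D, exists_forall_norm_coeff_mul_le R hC0 hD0 hC hD⟩

omit [Algebra ℤ_[p] R] [IsBoundedSMul ℤ_[p] R] [CompleteSpace R] in
/-- Membership in `boundedSeries`. -/
theorem mem_boundedSeries_iff (f : PowerSeries R) :
    f ∈ boundedSeries R ↔ ∃ C, ∀ n, ‖PowerSeries.coeff n f‖ ≤ C := Iff.rfl

/-! ### The bounded measures, with the transported ring structure -/

/-- THE BOUNDED MEASURES on `ℤ_p` with values in `R` — «`W[[Γ_𝔭]]`»: the bounded linear functionals on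
`C(ℤ_p, R)`. -/
abbrev BoundedMeasure : Type _ :=
  {m : C(ℤ_[p], R) →ₗ[R] R // ∃ C, ∀ φ, ‖m φ‖ ≤ C * ‖φ‖}

/-- The Amice bijection `BoundedMeasure ≃ boundedSeries` (T5AmiceInverse's `amiceEquiv`, re-typed). -/
noncomputable def amiceEquiv' : BoundedMeasure p R ≃ boundedSeries R :=
  amiceEquiv.trans (Equiv.subtypeEquivRight fun _ => Iff.rfl)

/-- `↑(amiceEquiv' m) = f_m`. -/
@[simp] theorem amiceEquiv'_apply_coe (m : BoundedMeasure p R) :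
    ((amiceEquiv' p R m : boundedSeries R) : PowerSeries R) = amice m.1 := rfl

/-- The ring structure on the bounded measures, transported from the bounded power series along the
Amice bijection. -/
noncomputable instance instCommRing : CommRing (BoundedMeasure p R) :=
  (amiceEquiv' p R).commRing

/-- THE RING ISOMORPHISM «`W[[Γ_𝔭]] ≅ W[[T]]`». -/
noncomputable def amiceRingEquiv : BoundedMeasure p R ≃+* boundedSeries R :=
  { amiceEquiv' p R with
    map_mul' := fun _ _ => (amiceEquiv' p R).apply_symm_apply _
    map_add' := fun _ _ => (amiceEquiv' p R).apply_symm_apply _ }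

/-- `↑(amiceRingEquiv m) = f_m`. -/
@[simp] theorem amiceRingEquiv_apply_coe (m : BoundedMeasure p R) :
    ((amiceRingEquiv p R m : boundedSeries R) : PowerSeries R) = amice m.1 := rfl

omit [Algebra ℤ_[p] R] [IsBoundedSMul ℤ_[p] R] [IsUltrametricDist R] [CompleteSpace R] in
/-- A bounded measure has a bound `≥ 0`. -/
theorem exists_nonneg_bound_val (m : BoundedMeasure p R) :
    ∃ C, 0 ≤ C ∧ ∀ φ, ‖m.1 φ‖ ≤ C * ‖φ‖ := by
  obtain ⟨C, hC⟩ := m.2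
  exact ⟨max C 0, le_max_right _ _, fun φ =>
    (hC φ).trans (mul_le_mul_of_nonneg_right (le_max_left C 0) (norm_nonneg φ))⟩

omit [Algebra ℤ_[p] R] [IsBoundedSMul ℤ_[p] R] [IsUltrametricDist R] [CompleteSpace R] in
/-- Every bounded measure is continuous. -/
theorem continuous_val (m : BoundedMeasure p R) : Continuous m.1 :=
  let ⟨C, hC⟩ := m.2
  continuous_of_bound m.1 C hC

omit [Algebra ℤ_[p] R] [IsBoundedSMul ℤ_[p] R] [IsUltrametricDist R] [CompleteSpace R] in
/-- The convolution of two bounded measures is continuous. -/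
theorem continuous_conv_val (m₁ m₂ : BoundedMeasure p R) :
    Continuous (conv m₁.1 m₂.1 (continuous_val p R m₂)) := by
  obtain ⟨C, hC0, hC⟩ := exists_nonneg_bound_val p R m₁
  obtain ⟨D, hD0, hD⟩ := exists_nonneg_bound_val p R m₂
  exact continuous_conv _ _ _ hC0 hD0 hC hD

/-- Two bounded measures with the same transform are equal. -/
theorem ext_of_amice_eq {m₁ m₂ : BoundedMeasure p R} (h : amice m₁.1 = amice m₂.1) : m₁ = m₂ :=
  Subtype.ext (eq_of_amice_eq (continuous_val p R m₁) (continuous_val p R m₂) h)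

/-- The transported PRODUCT IS THE CONVOLUTION: `(m₁ * m₂).1 = conv m₁.1 m₂.1`. -/
theorem mul_val_eq_conv (m₁ m₂ : BoundedMeasure p R) :
    (m₁ * m₂).1 = conv m₁.1 m₂.1 (continuous_val p R m₂) := by
  have h : amice (m₁ * m₂).1 = amice (conv m₁.1 m₂.1 (continuous_val p R m₂)) := by
    rw [amice_conv]
    have := congrArg (fun f : boundedSeries R => (f : PowerSeries R))
      ((amiceRingEquiv p R).map_mul m₁ m₂)
    simpa only [amiceRingEquiv_apply_coe, Subring.coe_mul] using this
  exact eq_of_amice_eq (continuous_val p R (m₁ * m₂)) (continuous_conv_val p R m₁ m₂) h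

/-- The transported SUM is the pointwise sum. -/
theorem add_val (m₁ m₂ : BoundedMeasure p R) : (m₁ + m₂).1 = m₁.1 + m₂.1 := by
  have h : amice (m₁ + m₂).1 = amice (m₁.1 + m₂.1) := by
    rw [amice_add]
    have := congrArg (fun f : boundedSeries R => (f : PowerSeries R))
      ((amiceRingEquiv p R).map_add m₁ m₂)
    simpa only [amiceRingEquiv_apply_coe, Subring.coe_add] using this
  refine eq_of_amice_eq (continuous_val p R (m₁ + m₂)) ?_ h
  have : ⇑(m₁.1 + m₂.1) = fun φ => m₁.1 φ + m₂.1 φ := rfl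
  rw [this]
  exact (continuous_val p R m₁).add (continuous_val p R m₂)

/-- The transported UNIT is `δ_0`. -/
theorem one_val_eq_dirac_zero : (1 : BoundedMeasure p R).1 = dirac (R := R) (0 : ℤ_[p]) := by
  have h : amice (1 : BoundedMeasure p R).1 = amice (dirac (R := R) (0 : ℤ_[p])) := by
    rw [amice_dirac_zero]
    have := congrArg (fun f : boundedSeries R => (f : PowerSeries R)) (amiceRingEquiv p R).map_one
    simpa only [amiceRingEquiv_apply_coe, Subring.coe_one] using this
  exact eq_of_amice_eq (continuous_val p R 1) (continuous_dirac 0) h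

/-- The transported ZERO is the zero functional. -/
theorem zero_val : (0 : BoundedMeasure p R).1 = 0 := by
  have h : amice (0 : BoundedMeasure p R).1 = amice (0 : C(ℤ_[p], R) →ₗ[R] R) := by
    have := congrArg (fun f : boundedSeries R => (f : PowerSeries R)) (amiceRingEquiv p R).map_zero
    simp only [amiceRingEquiv_apply_coe, Subring.coe_zero] at this
    rw [this]
    exact ((amice_eq_zero_iff 0 continuous_const).mpr rfl).symm
  exact eq_of_amice_eq (continuous_val p R 0) continuous_const h

/-- `δ_a` as a bounded measure. -/
noncomputable def diracB (a : ℤ_[p]) : BoundedMeasure p R :=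
  ⟨dirac (R := R) a, ⟨1, fun φ => norm_dirac_le a φ⟩⟩

/-- `δ_a · δ_b = δ_{a+b}` in the ring of bounded measures. -/
theorem diracB_mul (a b : ℤ_[p]) : diracB p R a * diracB p R b = diracB p R (a + b) := by
  apply Subtype.ext
  rw [mul_val_eq_conv]
  exact conv_dirac a b

/-- `δ_0 = 1`. -/
theorem diracB_zero : diracB p R 0 = 1 :=
  Subtype.ext (one_val_eq_dirac_zero p R).symm

/-- `f_{δ_1} = 1 + T`: the group element `γ₀ = δ_1` goes to `1 + T` under the ring isomorphism. -/
theorem amiceRingEquiv_diracB_one :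
    ((amiceRingEquiv p R (diracB p R 1) : boundedSeries R) : PowerSeries R) = 1 + PowerSeries.X := by
  rw [amiceRingEquiv_apply_coe]
  exact amice_dirac_one

end Summit.Ventures.HodgeRepro2.T5AmiceRingEquiv
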